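import Mathlib.Analysis.SpecialFunctions.Exp
import Mathlib.Analysis.SpecificLimits.Basic
import Mathlib.Algebra.BigOperators.Fin
import HarnessLib

/-!
# The common-coefficient linear independence criterion (Viola–Zudilin 2018, Lemma 5.1)

Topic `Literature/NumberTheory/DiophantineApproximation`. Everything here is PROVED (no definitions, no
named facts). The case `S = 3` of this lemma, with named variables, is
`ViolaZudilin.lemma51` in `DilogLandenLinearIndependenceProofs.lean`; here is the printed general form,
for a finite family `γ : ι → ℝ` with a distinguished index `i₀` (the paper's `γ_S`).

**Lemma 5.1** (Viola–Zudilin). Let `γ₁, …, γ_S ∈ ℝ` and, for every `n`, linear forms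
`r_n^{(μ)} = q_n γ_μ − p_n^{(μ)} ∈ ℤγ_μ + ℤ` (`μ = 1, …, S`) with a COMMON integer coefficient `q_n`, such that
(i) `limsup (1/n) log |r_n^{(S)}| = −τ` for some `τ > 0` and `limsup (1/n) log |r_n^{(μ)}| < −τ` for
`μ < S`; (ii) `1, γ₁, …, γ_{S−1}` are linearly independent over `ℚ`. Then `1, γ₁, …, γ_S` are linearly
independent over `ℚ`.

We render (i) by rates `ρ₁ < ρ₂` (`0 < ρ₂`): `|r_n^{(μ)}| ≤ e^{−ρ₂n}` eventually for `μ ≠ S`, `r_n^{(S)} → 0`,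
and `|r_n^{(S)}| ≥ e^{−ρ₁n}` for infinitely many `n` — consequences of the printed `limsup` conditions
(`ρ₁ = τ + ε/2`, `ρ₂ = τ + ε`) — and linear (in)dependence by integer relations (clear denominators for `ℚ`).
Proof as printed: a relation `Λ = a₀ + Σ a_μ γ_μ = 0` gives
`0 = q_nΛ = (a₀q_n + Σ a_μ p_n^{(μ)}) + Σ a_μ r_n^{(μ)}`; the integer in brackets tends to `0`, hence vanishes
for large `n`, so `a_S r_n^{(S)} = −Σ_{μ<S} a_μ r_n^{(μ)} = O(e^{−ρ₂ n})`, contradicting `|r_n^{(S)}| ≥ e^{−ρ₁n}`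
infinitely often unless `a_S = 0`; then (ii).

## References

* C. Viola, W. Zudilin, *Linear independence of dilogarithmic values*, J. reine angew. Math. 736 (2018)
  193–223, Lemma 5.1. [ViolaZudilin2018]
-/

noncomputable section

namespace Literature.NumberTheory.DiophantineApproximation

namespace ViolaZudilin

open _root_.Filter _root_.Topology Finset

/-- **Viola–Zudilin 2018, Lemma 5.1 (common-coefficient criterion), general finite family.**
`γ : ι → ℝ`, integer sequences `Q_n` (common coefficient) and `P_n : ι → ℤ`, a distinguished index `i₀`
and rates `ρ₁ < ρ₂`, `0 < ρ₂`, with `|Q_n γ_i − P_n i| ≤ e^{−ρ₂ n}` eventually for `i ≠ i₀`,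
`Q_n γ_{i₀} − P_n i₀ → 0` and `≥ e^{−ρ₁ n}` in absolute value infinitely often. If `1` and the `γ_i`, `i ≠ i₀`,
admit no non-trivial integer relation, then neither do `1` and all the `γ_i`.
[cite: ViolaZudilin2018, Lemma 5.1] -/
theorem intRelation_trivial_of_common_coefficient_forms {ι : Type*} [Fintype ι] [DecidableEq ι]
    (γ : ι → ℝ) (i₀ : ι) (Q : ℕ → ℤ) (P : ℕ → ι → ℤ) {ρ₁ ρ₂ : ℝ} (hρ : ρ₁ < ρ₂) (hρ₂ : 0 < ρ₂)
    (hsmall : ∀ i, i ≠ i₀ → ∀ᶠ n : ℕ in atTop, |Q n * γ i - P n i| ≤ Real.exp (-(ρ₂ * n)))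
    (hzero : Tendsto (fun n : ℕ => Q n * γ i₀ - P n i₀) atTop (𝓝 0))
    (hbig : ∃ᶠ n : ℕ in atTop, Real.exp (-(ρ₁ * n)) ≤ |Q n * γ i₀ - P n i₀|)
    (hind : ∀ (a₀ : ℤ) (a : ι → ℤ), a i₀ = 0 → (a₀ : ℝ) + ∑ i, (a i : ℝ) * γ i = 0 →
      a₀ = 0 ∧ a = 0)
    (a₀ : ℤ) (a : ι → ℤ) (hrel : (a₀ : ℝ) + ∑ i, (a i : ℝ) * γ i = 0) : a₀ = 0 ∧ a = 0 := by
  -- remainders and the error combination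
  set r : ι → ℕ → ℝ := fun i n => Q n * γ i - P n i with hr
  set E : ℕ → ℝ := fun n => ∑ i, (a i : ℝ) * r i n with hE
  -- the integer `M_n = a₀ Q_n + Σ aᵢ P_n i` equals `-E_n`
  have hM : ∀ n, ((a₀ * Q n + ∑ i, a i * P n i : ℤ) : ℝ) = -E n := by
    intro n
    have h0 : (Q n : ℝ) * ((a₀ : ℝ) + ∑ i, (a i : ℝ) * γ i) = 0 := by rw [hrel, mul_zero]
    have h1 : (Q n : ℝ) * ((a₀ : ℝ) + ∑ i, (a i : ℝ) * γ i)
        = ((a₀ * Q n + ∑ i, a i * P n i : ℤ) : ℝ) + E n := by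
      push_cast
      simp only [hE, hr]
      rw [mul_add, Finset.mul_sum, add_assoc, ← Finset.sum_add_distrib]
      congr 1
      · ring
      · exact Finset.sum_congr rfl fun i _ => by ring
    linarith
  -- every remainder tends to `0`, hence `E_n → 0`
  have hexp : Tendsto (fun n : ℕ => Real.exp (-(ρ₂ * n))) atTop (𝓝 0) :=
    Real.tendsto_exp_atBot.comp
      (tendsto_neg_atTop_atBot.comp (tendsto_natCast_atTop_atTop.const_mul_atTop hρ₂))
  have hri : ∀ i, Tendsto (r i) atTop (𝓝 0) := by
    intro i
    by_cases hi : i = i₀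
    · subst hi; exact hzero
    · exact squeeze_zero_norm'
        (by filter_upwards [hsmall i hi] with n hn; simpa [Real.norm_eq_abs] using hn) hexp
  have htE : Tendsto E atTop (𝓝 0) := by
    have h := tendsto_finsetSum (Finset.univ : Finset ι) fun i _ => (hri i).const_mul (a i : ℝ)
    simpa [hE] using h
  -- the integer vanishes, so `E_n = 0` for all large `n`
  have hE0 : ∀ᶠ n : ℕ in atTop, E n = 0 := by
    filter_upwards [htE.eventually_lt_const zero_lt_one,
      htE.eventually_const_lt (show (-1 : ℝ) < 0 by norm_num)] with n hlt hgt
    have habs : |((a₀ * Q n + ∑ i, a i * P n i : ℤ) : ℝ)| < 1 := by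
      rw [hM, abs_neg, abs_lt]; exact ⟨hgt, hlt⟩
    have hint : a₀ * Q n + ∑ i, a i * P n i = 0 := by
      rw [← Int.abs_lt_one_iff]; exact_mod_cast habs
    have := hM n
    rw [hint, Int.cast_zero] at this
    linarith
  -- `a i₀ = 0`: otherwise `|r_{i₀}| ≤ (Σ_{i ≠ i₀} |aᵢ|) e^{-ρ₂ n}` eventually, against `hbig`
  have hsmall' : ∀ᶠ n : ℕ in atTop, ∀ i, i ≠ i₀ → |r i n| ≤ Real.exp (-(ρ₂ * n)) := by
    have h : ∀ i ∈ (Finset.univ : Finset ι).erase i₀,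
        ∀ᶠ n : ℕ in atTop, |r i n| ≤ Real.exp (-(ρ₂ * n)) := fun i hi =>
      hsmall i (Finset.ne_of_mem_erase hi)
    filter_upwards [(Finset.eventually_all _).2 h] with n hn i hi
    exact hn i (Finset.mem_erase.2 ⟨hi, Finset.mem_univ i⟩)
  have hK : ∀ᶠ n : ℕ in atTop,
      (∑ i ∈ Finset.univ.erase i₀, |(a i : ℝ)|) * Real.exp (-(ρ₂ * n)) < Real.exp (-(ρ₁ * n)) := by
    set K := ∑ i ∈ Finset.univ.erase i₀, |(a i : ℝ)| with hKdef
    have h : Tendsto (fun n : ℕ => Real.exp ((ρ₂ - ρ₁) * n)) atTop atTop :=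
      Real.tendsto_exp_atTop.comp (tendsto_natCast_atTop_atTop.const_mul_atTop (sub_pos.2 hρ))
    filter_upwards [h.eventually_gt_atTop K] with n hn
    have hpos : 0 < Real.exp (-(ρ₂ * n)) := Real.exp_pos _
    calc K * Real.exp (-(ρ₂ * n)) < Real.exp ((ρ₂ - ρ₁) * n) * Real.exp (-(ρ₂ * n)) :=
          mul_lt_mul_of_pos_right hn hpos
      _ = Real.exp (-(ρ₁ * n)) := by rw [← Real.exp_add]; ring_nf
  have ha₀ : a i₀ = 0 := by
    by_contra hne
    have hd1 : (1 : ℝ) ≤ |(a i₀ : ℝ)| := by exact_mod_cast Int.one_le_abs hne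
    apply hbig
    filter_upwards [hE0, hsmall', hK] with n hEn hsn hKn
    rw [not_le]
    -- split `E_n = a_{i₀} r_{i₀} + Σ_{i ≠ i₀} aᵢ rᵢ = 0`
    have hsplit : (a i₀ : ℝ) * r i₀ n + ∑ i ∈ Finset.univ.erase i₀, (a i : ℝ) * r i n = 0 := by
      have h := Finset.add_sum_erase Finset.univ (fun i => (a i : ℝ) * r i n) (Finset.mem_univ i₀)
      rw [h]
      simpa [hE] using hEn
    have hbound : |(a i₀ : ℝ)| * |r i₀ n|
        ≤ (∑ i ∈ Finset.univ.erase i₀, |(a i : ℝ)|) * Real.exp (-(ρ₂ * n)) := by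
      rw [← abs_mul, show (a i₀ : ℝ) * r i₀ n = -∑ i ∈ Finset.univ.erase i₀, (a i : ℝ) * r i n by
        linarith, abs_neg, Finset.sum_mul]
      refine (Finset.abs_sum_le_sum_abs _ _).trans (Finset.sum_le_sum fun i hi => ?_)
      rw [abs_mul]
      exact mul_le_mul_of_nonneg_left (hsn i (Finset.ne_of_mem_erase hi)) (abs_nonneg _)
    calc |(Q n : ℝ) * γ i₀ - P n i₀| = |r i₀ n| := rfl
      _ ≤ |(a i₀ : ℝ)| * |r i₀ n| := le_mul_of_one_le_left (abs_nonneg _) hd1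
      _ ≤ (∑ i ∈ Finset.univ.erase i₀, |(a i : ℝ)|) * Real.exp (-(ρ₂ * n)) := hbound
      _ < Real.exp (-(ρ₁ * n)) := hKn
  exact hind a₀ a ha₀ hrel

end ViolaZudilin

end Literature.NumberTheory.DiophantineApproximation

end
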